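import Literature.Computability.AlgebraicComplexity.DDS21EpsIntegralFractions
import Literature.Computability.AlgebraicComplexity.DDS21GradedFractions
import Literature.Computability.AlgebraicComplexity.UABPToolkit
import Literature.Computability.AlgebraicComplexity.DDS21GradedFractionsEps
import Literature.Computability.AlgebraicComplexity.DDS21DiDILStep
import Literature.Computability.AlgebraicComplexity.DDS21DeborderReadOnce
import Literature.Computability.AlgebraicComplexity.DDS21TopFaninTwoTraceBack
import HarnessLib

/-!
# Dutta–Dwivedi–Saxena 2021, §3: the DiDIL end game `j = k − 1` (Claim 3.3's input, exact frame)

Theorem-only companion (cell `val-lit`, np lane, DDS21 Thm 3.2 programme "M-b", brick **B4c (E3)**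
of the memo `HOME/np/MEMO-t21g12-DDS21-B4-DiDIL.md` §4, lead-np RULING (135)(d)) for P. Dutta,
P. Dwivedi, N. Saxena, *Demystifying the border of depth-3 algebraic circuits*, FOCS 2021
[DuttaDwivediSaxena2022], held FULL VERSION `paper:galaxy-pdf-7641649743695546420` (chunk
`pNNNN.txt`, printed line `Lnnn`): §3, proof of Thm. 3.2, the end of the DiDIL induction
("`k − 1` many times … we reach `j = k − 1`, i.e. … `g_{k−1} ∈ Gen(1,·)` approximates `f_{k−1}`",
p0033 L891 – p0034 L897) feeding Claim 3.3 ("`\overline{Gen(1,s)} ⊆ ABP/ABP`", p0027 L724–744).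

## What is proved (no definitions, no named facts)

In the EXACT frame of RULING (132)(a) (memo findings F3/R1: the DiDIL terms are honest elements of
`F(ε)(x) = Frac(F(ε)[x])`, their `Σ∧Σ` structure is carried by graded CERTIFICATES
`gcomp p Π c ∈ Σ∧Σ` for the numerator polynomials `p` over products `Π` of affine forms, brick B4a's
`DDS2021.gcomp`), the last stage hands over ONE term

  `T = C κ · (U/V) · (p/Π_P) / (q/Π_Q)`,  i.e.  `T · (V · q · Π_P) = C κ · U · p · Π_Q`  in `F(ε)(x)`,

with `U, V, Π_P, Π_Q` products of affine forms over `F(ε)` and `EpsLim T f` ("`lim_{ε→0} g_{k−1} =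
f_{k−1}`", brick E1's `DDS2021.EpsLim`). This file proves the `ε → 0` step of Claim 3.3 for such a
term COMPONENTWISE — the sibling of the tree's `DDS2021.deborder_gen_one` (which needs `p, q ∈ Σ∧Σ`
globally) that the exact frame requires:

* §1 `exists_regularModel_prod_affine`: a product of `ε`-REGULAR affine forms `ℓ = c · ι(ℓ̂)`
  (`ℓ̂` with coefficients in `F[ε]` and constant term an `ε`-unit — what the generic shift `α` of
  the source provides, "`Φ(T_{i,0})|_{x=0} = T_{i,0}(α) ∈ F(ε) ∖ {0}`", p0028 L753–754, in the
  strengthened reading recorded in `HOME/np/NOTE-t19g11-DDS21-B4-eps-side.md` §1(b)) is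
  `C c · ι(X̂)` with `X̂(ε=0) ∈ ΠΣ` over `F` and NONZERO CONSTANT TERM (a graded unit).
* §2 `gcomp_model_mem_swsClass`: graded certificates pass to the `ε`-normal forms
  (`gcomp (ι p̂) (ι Π̂) c = C(c_Π/c_p) · gcomp p Π c`, representation independence `gcomp_congr`).
* §3 ★ `deborder_exactTerm`: the order of the total scalar is `≥ 0` and the RESIDUE IDENTITY
  `f · (V̂₀ · q̂₀ · Π̂_{P,0}) = C u · (Û₀ · p̂₀ · Π̂_{Q,0})` in `F(x)` with `u ≠ 0 ↔ f ≠ 0`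
  ("`val_ε(…) ≥ 0` … if it is `≥ 1` then `f = 0` … `= 0` implies
  `f = (lim Ũ/lim Ṽ)·(lim P̃/lim Q̃)`", p0027 L733–737), all four `ΠΣ` reductions in `ΠΣ` over `F`
  with nonzero constant terms, `p̂₀ = p̂(ε=0) ≠ 0`, `q̂₀ ≠ 0`, the `ε`-normal forms of `p, q`, and
  the certificates transferred to the integral models `(p̂, Π̂_P)`, `(q̂, Π̂_Q)` — the shape from
  which `gcomp (p̂(0)) (Π̂_P(0)) c ∈ \overline{Σ∧Σ}` (brick `DDS21GradedFractionsEps.lean`,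
  `gcomp_redZero_mem_border`) and then ABPs (`uabpComputes_of_mem_border_swsClass`, Lemma 2.23)
  follow downstream.
* §4 `epsLim_zero_iff`-type bookkeeping for the degenerate term `p = 0`.

Inputs BY NAME: E1 `DDS21EpsIntegralFractions.lean` (`EpsLim`, `epsLim_intToFrac`,
`EpsLim.exists_eq_C_mul_of_normalForm`, `IsEpsInt.exists_ord_of_normalForm`, `algebraMap_C_div`),
B0-ext `DDS21BloatedRatioDeborder.lean` (`exists_epsNormalForm`), B4a `DDS21GradedFractions.lean`
(`gcomp`, `gcomp_congr`, `gcomp_C_mul`), B2 `DDS21DepthThreeDiagonalToolkit.lean`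
(`C_mul_mem_swsClass`). The hypothesis shape `T · ι(V q Π_P) = ι(C κ U p Π_Q)` is brick B4b's
`ExactTerm.val_mul_denPoly` (`numPoly = C κ·∏num·p·den_Q`, `denPoly = ∏den·q·den_P`).

Honest framing: elementary `ε`-adic bookkeeping for the last stage of a published, surveyed 2021
theorem; nothing here bears on VP versus VNP, which is NOT proved; `DDS2021_thm_3_2` and
`DDS2021_thm_5_1` remain OPEN named facts.

## References

* [DuttaDwivediSaxena2022] P. Dutta, P. Dwivedi, N. Saxena, *Demystifying the border of depth-3
  algebraic circuits*, Proc. 62nd FOCS (2021), IEEE 2022, 92–103; full version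
  `paper:galaxy-pdf-7641649743695546420`: §2 "Valuation" p0015 L407–410; Def. 3.1 p0026 L702–707;
  Claim 3.3 with proof p0027 L724–744; the map `Φ` p0028 L751–760; induction hypotheses p0030
  L799–812; end of the induction p0033 L891 – p0034 L897; Lemma 2.23 p0025 L661–664.
-/

noncomputable section

open MvPolynomial
open scoped BigOperators Polynomial

namespace Literature.Computability.AlgebraicComplexity

namespace DDS2021

/-! ## §1 `ε`-regular affine forms and their products -/

section RegularForms

variable {F : Type*} [Field F] {n : ℕ}

/-- Mapping the coefficients of an affine form `a₀ + ∑_m a_m x_m`. (folklore)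
[cite: DuttaDwivediSaxena2022, Def. 3.1 (full version p0026 L702–707)] -/
theorem map_affForm {R S : Type*} [CommSemiring R] [CommSemiring S] (φ : R →+* S)
    (a : Option (Fin n) → R) :
    map φ (C (a none) + ∑ m, C (a (some m)) * X m) =
      C (φ (a none)) + ∑ m, C (φ (a (some m))) * X m := by
  rw [map_add, map_C, map_sum]
  refine congrArg _ (Finset.sum_congr rfl fun m _ => ?_)
  rw [map_mul, map_C, map_X]

/-- The constant term of an affine form `a₀ + ∑_m a_m x_m` is `a₀`. (folklore)
[cite: DuttaDwivediSaxena2022, Def. 3.1 (full version p0026 L702–707)] -/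
theorem constantCoeff_affForm {R : Type*} [CommSemiring R] (a : Option (Fin n) → R) :
    constantCoeff (C (a none) + ∑ m, C (a (some m)) * X m) = a none := by
  rw [map_add, constantCoeff_C, map_sum, Finset.sum_eq_zero, add_zero]
  intro m _
  rw [map_mul, constantCoeff_X, mul_zero]

/-- A product of `D` affine forms is a `ΠΣ = Σ^{[1]}Π^{[D]}Σ` circuit ("`U_i, V_i ∈ ΠΣ`", Def. 3.1).
[cite: DuttaDwivediSaxena2022, Def. 3.1 (full version p0026 L702–707)] -/
theorem prod_affForm_mem_spsClass {K : Type*} [Field K] {D : ℕ} (a : Fin D → Option (Fin n) → K) :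
    (∏ j, (C (a j none) + ∑ m, C (a j (some m)) * X m) : MvPolynomial (Fin n) K) ∈
      spsClass K n 1 D :=
  ⟨fun _ => a, by rw [Fin.sum_univ_one]⟩

/-- The constant term of a product of affine forms is the product of the constant terms. (folklore)
[cite: DuttaDwivediSaxena2022, Def. 3.1 (full version p0026 L702–707)] -/
theorem coeff_zero_prod_affForm {R : Type*} [CommSemiring R] {D : ℕ} (a : Fin D → Option (Fin n) → R) :
    coeff 0 (∏ j, (C (a j none) + ∑ m, C (a j (some m)) * X m) : MvPolynomial (Fin n) R) =
      ∏ j, a j none := by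
  rw [← constantCoeff_eq, map_prod]
  exact Finset.prod_congr rfl fun j _ => constantCoeff_affForm (a j)

/-- **Regular `ΠΣ` products have regular integral models.** If every affine form of a product over
`F(ε)` is `ε`-REGULAR — its coefficient vector is `c · ι(b)` with `c ∈ F(ε)^×`, `b` over `F[ε]`
and `b₀(0) ≠ 0` (the constant term carries the `ε`-adic order of the form: the strengthened
genericity of the shift `α`, "`T_{i,0}(α) ∈ F(ε)∖{0}`" read for the REDUCED normalised forms) —
then the product is `C c · ι(X̂)` with `c ≠ 0`, `X̂ ∈ F[ε][x]`, `X̂(ε=0)` a product of `D` affine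
forms over `F` (so `∈ ΠΣ` over `F`: "`\overline{ΠΣ} = ΠΣ`", Claim 3.3 proof) whose constant term is
NONZERO. [cite: DuttaDwivediSaxena2022, §3 the map Φ (full version p0028 L751–754) and Claim 3.3 proof (p0027 L737–744)] -/
theorem exists_regularModel_prod_affine {D : ℕ} (a : Fin D → Option (Fin n) → RatFunc F)
    (ha : ∀ j, ∃ (c : RatFunc F) (b : Option (Fin n) → F[X]), c ≠ 0 ∧
      (∀ o, a j o = c * algebraMap F[X] (RatFunc F) (b o)) ∧ (b none).coeff 0 ≠ 0) :
    ∃ (c : RatFunc F) (Xh : MvPolynomial (Fin n) F[X]), c ≠ 0 ∧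
      (∏ j, (C (a j none) + ∑ m, C (a j (some m)) * X m) : MvPolynomial (Fin n) (RatFunc F)) =
        C c * map (algebraMap F[X] (RatFunc F)) Xh ∧
      coeff 0 (redZero F (Fin n) Xh) ≠ 0 ∧ redZero F (Fin n) Xh ∈ spsClass F n 1 D := by
  choose c b hc hab hb using ha
  refine ⟨∏ j, c j, ∏ j, (C (b j none) + ∑ m, C (b j (some m)) * X m),
    Finset.prod_ne_zero_iff.mpr (fun j _ => hc j), ?_, ?_, ?_⟩
  · rw [map_prod (map (algebraMap F[X] (RatFunc F))), map_prod C, ← Finset.prod_mul_distrib]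
    refine Finset.prod_congr rfl fun j _ => ?_
    rw [map_affForm, mul_add, ← C_mul, ← hab, Finset.mul_sum]
    refine congrArg _ (Finset.sum_congr rfl fun m _ => ?_)
    rw [← mul_assoc, ← C_mul, ← hab]
  · rw [redZero_apply, map_prod (map (Polynomial.constantCoeff : F[X] →+* F))]
    simp only [map_affForm]
    rw [coeff_zero_prod_affForm (fun j o => Polynomial.constantCoeff (b j o))]
    exact Finset.prod_ne_zero_iff.mpr fun j _ => by
      rw [Polynomial.constantCoeff_apply]; exact hb j
  · rw [redZero_apply, map_prod (map (Polynomial.constantCoeff : F[X] →+* F))]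
    simp only [map_affForm]
    exact prod_affForm_mem_spsClass (fun j o => Polynomial.constantCoeff (b j o))

end RegularForms

/-! ## §2 Transfer of graded certificates to `ε`-normal forms -/

section Transfer

variable {F : Type*} [Field F] {n : ℕ}

/-- If `Q = C c · ι(Q̂)` with `c ≠ 0` and `Q̂(ε=0)` has nonzero constant term, then `Q` and `ι(Q̂)`
have nonzero constant terms (so `gcomp _ Q`, `gcomp _ (ι Q̂)` are graded divisions by units).
(folklore) [cite: DuttaDwivediSaxena2022, Claim 3.3 proof, "1/R does not contain negative powers" (full version p0027 L737–744)] -/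
theorem coeff_zero_ne_zero_of_model {c : RatFunc F} (hc : c ≠ 0) {Q : MvPolynomial (Fin n) (RatFunc F)}
    {Qh : MvPolynomial (Fin n) F[X]} (hQ : Q = C c * map (algebraMap F[X] (RatFunc F)) Qh)
    (hQh : coeff 0 (redZero F (Fin n) Qh) ≠ 0) :
    coeff 0 Q ≠ 0 ∧ coeff 0 (map (algebraMap F[X] (RatFunc F)) Qh) ≠ 0 := by
  have h1 : coeff 0 Qh ≠ 0 := by
    intro h0
    apply hQh
    rw [redZero_apply, coeff_map, h0, map_zero]
  have h2 : coeff 0 (map (algebraMap F[X] (RatFunc F)) Qh) ≠ 0 := by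
    rw [coeff_map]
    exact fun h0 => h1 (RatFunc.algebraMap_injective F (by rw [h0, map_zero]))
  refine ⟨?_, h2⟩
  rw [hQ, coeff_C_mul]
  exact mul_ne_zero hc h2

/-- **Certificates pass to the normal forms.** If `p = C c_p · ι(p̂)`, `Q = C c_Q · ι(Q̂)` with
`c_p ≠ 0` and unit constant terms, then `gcomp (ι p̂) (ι Q̂) c = C (c_Q/c_p) · gcomp p Q c`; in
particular a `Σ∧Σ` certificate for the degree-`c` piece of `p/Q` is one for `p̂/Q̂` (same fan-in,
`Σ∧Σ` being closed under scalars). [cite: DuttaDwivediSaxena2022, Claim 3.3 proof (full version p0027 L729–744); §2.3 (p0020 L537–540)] -/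
theorem gcomp_model_mem_swsClass {t e c : ℕ} {p Q : MvPolynomial (Fin n) (RatFunc F)}
    {cp cQ : RatFunc F} (hcp : cp ≠ 0) {ph Qh : MvPolynomial (Fin n) F[X]}
    (hp : p = C cp * map (algebraMap F[X] (RatFunc F)) ph)
    (hQ : Q = C cQ * map (algebraMap F[X] (RatFunc F)) Qh) (hQ0 : coeff 0 Q ≠ 0)
    (hQh0 : coeff 0 (map (algebraMap F[X] (RatFunc F)) Qh) ≠ 0)
    (h : gcomp p Q c ∈ swsClass (RatFunc F) n t e) :
    gcomp (map (algebraMap F[X] (RatFunc F)) ph) (map (algebraMap F[X] (RatFunc F)) Qh) c ∈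
      swsClass (RatFunc F) n t e := by
  have key : gcomp (map (algebraMap F[X] (RatFunc F)) ph) (map (algebraMap F[X] (RatFunc F)) Qh) =
      gcomp (C (cQ / cp) * p) Q :=
    gcomp_congr hQh0 hQ0 (by
      have hcc : C (cQ / cp) * C cp = (C cQ : MvPolynomial (Fin n) (RatFunc F)) := by
        rw [← C_mul, div_mul_cancel₀ cQ hcp]
      rw [hp, hQ]
      linear_combination (-(map (algebraMap F[X] (RatFunc F)) ph *
        map (algebraMap F[X] (RatFunc F)) Qh)) * hcc)
  rw [key, gcomp_C_mul, smul_eq_C_mul]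
  exact C_mul_mem_swsClass _ h

/-- The total degree does not grow under a change of coefficients. (folklore)
[cite: DuttaDwivediSaxena2022, §2 "Valuation" (full version p0015 L407–410)] -/
theorem totalDegree_map_le_totalDegree {R S : Type*} [CommSemiring R] [CommSemiring S] {σ : Type*}
    (φ : R →+* S) (P : MvPolynomial σ R) : (map φ P).totalDegree ≤ P.totalDegree :=
  Finset.sup_mono (support_map_subset φ P)

/-- The reduction `p̂(ε=0)` of an `ε`-normal form `p = C c · ι(p̂)` (`c ≠ 0`) has total degree at
most that of `p`. (folklore) [cite: DuttaDwivediSaxena2022, §2 "Valuation" (full version p0015 L407–410)] -/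
theorem totalDegree_redZero_le_of_model {c : RatFunc F} (hc : c ≠ 0)
    {p : MvPolynomial (Fin n) (RatFunc F)} {ph : MvPolynomial (Fin n) F[X]}
    (hp : p = C c * map (algebraMap F[X] (RatFunc F)) ph) :
    (redZero F (Fin n) ph).totalDegree ≤ p.totalDegree := by
  have h1 : (redZero F (Fin n) ph).totalDegree ≤ ph.totalDegree :=
    totalDegree_map_le_totalDegree _ _
  have h2 : ph.totalDegree = (map (algebraMap F[X] (RatFunc F)) ph).totalDegree := by
    simp only [totalDegree, support_map_of_injective ph (RatFunc.algebraMap_injective F)]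
  have h3 : map (algebraMap F[X] (RatFunc F)) ph = C c⁻¹ * p := by
    rw [hp, ← mul_assoc, ← C_mul, inv_mul_cancel₀ hc, C_1, one_mul]
  have h4 : (map (algebraMap F[X] (RatFunc F)) ph).totalDegree ≤ p.totalDegree := by
    rw [h3]
    exact (totalDegree_mul _ _).trans (by rw [totalDegree_C, zero_add])
  omega

end Transfer

/-! ## §3 The end game: de-bordering the last exact term -/

section EndGame

variable {F : Type*} [Field F] {n : ℕ}

/-- Assembling the `ε`-normal form of a product of three normal forms. (folklore)
[cite: DuttaDwivediSaxena2022, Claim 3.3 proof (full version p0027 L729–733)] -/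
theorem normalForm_mul₃ (c₁ c₂ c₃ : RatFunc F) (G₁ G₂ G₃ : MvPolynomial (Fin n) F[X]) :
    C c₁ * map (algebraMap F[X] (RatFunc F)) G₁ * (C c₂ * map (algebraMap F[X] (RatFunc F)) G₂) *
        (C c₃ * map (algebraMap F[X] (RatFunc F)) G₃) =
      C (c₁ * c₂ * c₃) * map (algebraMap F[X] (RatFunc F)) (G₁ * G₂ * G₃) := by
  simp only [map_mul]
  ring

/-- **DDS Claim 3.3's `ε → 0` step for the LAST EXACT DiDIL TERM, componentwise** (brick B4c (E3)).
Data: the single term of stage `k − 1`, `T ∈ F(ε)(x)`, in the exact-object currency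
`T · (V · q · Π_P) = C κ · U · p · Π_Q` (`U, V, Π_P, Π_Q` products of `ε`-regular affine forms with
regular models, `κ ∈ F(ε)^×`, `p, q ≠ 0` the numerators of the `Σ∧Σ`-certified graded fractions
`p/Π_P`, `q/Π_Q`: `gcomp p Π_P c, gcomp q Π_Q c ∈ Σ∧Σ(t, e c)` for `c < N`), with `lim_{ε→0} T = f`
(`EpsLim T f`, "`g_{k−1}` approximates `f_{k−1}`", induction hypothesis (1), p0030 L799–801).
Conclusion ("`T =: ε^{a}·T̃` … Since the left side is well-defined at `ε = 0`, it must happen that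
`a ≥ 0` … if `≥ 1` then `f = 0` … `= 0` implies `f = (lim Ũ/lim Ṽ)·(lim P̃/lim Q̃)`", Claim 3.3
proof p0027 L729–737, for the exact term), given the regular models `U = C c_U·ι(Û)`,
`V = C c_V·ι(V̂)`, `Π_P = C c_P·ι(Π̂_P)`, `Π_Q = C c_Q·ι(Π̂_Q)` (`Û(0), V̂(0) ≠ 0`; `Π̂_P(0)`,
`Π̂_Q(0)` with nonzero constant terms — §1): `ε`-normal forms `p = C c_p·ι(p̂)`, `q = C c_q·ι(q̂)`
with `p̂(0), q̂(0) ≠ 0` of total degree `≤ deg p, deg q`, the graded certificates TRANSFERRED to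
the models `(p̂, Π̂_P)`, `(q̂, Π̂_Q)`, and the RESIDUE IDENTITY in `F(x)`:
`f · (V̂(0) · q̂(0) · Π̂_P(0)) = C u · (Û(0) · p̂(0) · Π̂_Q(0))`, `u ≠ 0 ↔ f ≠ 0`.
The componentwise sibling of the tree's `deborder_gen_one` (global `Σ∧Σ` hypotheses there,
graded certificates here, as the exact frame of RULING (132)(a) requires).
[cite: DuttaDwivediSaxena2022, Claim 3.3 with proof (full version p0027 L724–744); §3 end of the DiDIL induction (p0033 L891 – p0034 L897)] -/
theorem deborder_exactTerm {N t : ℕ} {e : ℕ → ℕ}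
    {T : FractionRing (MvPolynomial (Fin n) (RatFunc F))}
    {f : FractionRing (MvPolynomial (Fin n) F)} (hT : EpsLim T f)
    {κ : RatFunc F} (hκ : κ ≠ 0) {U V p q PiP PiQ : MvPolynomial (Fin n) (RatFunc F)}
    {cU cV cP cQ : RatFunc F} {Uh Vh Ph Qh : MvPolynomial (Fin n) F[X]}
    (hcU : cU ≠ 0) (hUe : U = C cU * map (algebraMap F[X] (RatFunc F)) Uh)
    (hU0 : redZero F (Fin n) Uh ≠ 0)
    (hcV : cV ≠ 0) (hVe : V = C cV * map (algebraMap F[X] (RatFunc F)) Vh)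
    (hV0 : redZero F (Fin n) Vh ≠ 0)
    (hcP : cP ≠ 0) (hPe : PiP = C cP * map (algebraMap F[X] (RatFunc F)) Ph)
    (hP0 : coeff 0 (redZero F (Fin n) Ph) ≠ 0)
    (hcQ : cQ ≠ 0) (hQe : PiQ = C cQ * map (algebraMap F[X] (RatFunc F)) Qh)
    (hQ0 : coeff 0 (redZero F (Fin n) Qh) ≠ 0)
    (hp : p ≠ 0) (hq : q ≠ 0)
    (hrel : T * algebraMap (MvPolynomial (Fin n) (RatFunc F))
        (FractionRing (MvPolynomial (Fin n) (RatFunc F))) (V * q * PiP) =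
      algebraMap (MvPolynomial (Fin n) (RatFunc F))
        (FractionRing (MvPolynomial (Fin n) (RatFunc F))) (C κ * U * p * PiQ))
    (hcertP : ∀ c < N, gcomp p PiP c ∈ swsClass (RatFunc F) n t (e c))
    (hcertQ : ∀ c < N, gcomp q PiQ c ∈ swsClass (RatFunc F) n t (e c)) :
    ∃ (u : F) (cp cq : RatFunc F) (ph qh : MvPolynomial (Fin n) F[X]),
      -- the `ε`-normal forms of the `Σ∧Σ` numerators
      cp ≠ 0 ∧ p = C cp * map (algebraMap F[X] (RatFunc F)) ph ∧ redZero F (Fin n) ph ≠ 0 ∧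
      (redZero F (Fin n) ph).totalDegree ≤ p.totalDegree ∧
      cq ≠ 0 ∧ q = C cq * map (algebraMap F[X] (RatFunc F)) qh ∧ redZero F (Fin n) qh ≠ 0 ∧
      (redZero F (Fin n) qh).totalDegree ≤ q.totalDegree ∧
      -- the graded certificates, transferred to the integral models
      (∀ c < N, gcomp (map (algebraMap F[X] (RatFunc F)) ph)
          (map (algebraMap F[X] (RatFunc F)) Ph) c ∈ swsClass (RatFunc F) n t (e c)) ∧
      (∀ c < N, gcomp (map (algebraMap F[X] (RatFunc F)) qh)
          (map (algebraMap F[X] (RatFunc F)) Qh) c ∈ swsClass (RatFunc F) n t (e c)) ∧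
      -- the residue identity in `F(x)`
      f * limToFrac F (Fin n) (redZero F (Fin n) Vh * redZero F (Fin n) qh * redZero F (Fin n) Ph) =
        limToFrac F (Fin n)
          (C u * (redZero F (Fin n) Uh * redZero F (Fin n) ph * redZero F (Fin n) Qh)) ∧
      (u ≠ 0 ↔ f ≠ 0) := by
  have hP0' : redZero F (Fin n) Ph ≠ 0 := fun h => hP0 (by rw [h, coeff_zero])
  have hQ0' : redZero F (Fin n) Qh ≠ 0 := fun h => hQ0 (by rw [h, coeff_zero])
  obtain ⟨cp, ph, hcp, hpe, hph⟩ := exists_epsNormalForm p hp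
  obtain ⟨cq, qh, hcq, hqe, hqh⟩ := exists_epsNormalForm q hq
  rw [← redZero_apply] at hph hqh
  -- the two total normal forms `C m · ι(M)` and `C d · ι(E)`
  obtain ⟨M, hM⟩ : ∃ M : MvPolynomial (Fin n) F[X], Uh * ph * Qh = M := ⟨_, rfl⟩
  obtain ⟨E, hE⟩ : ∃ E : MvPolynomial (Fin n) F[X], Vh * qh * Ph = E := ⟨_, rfl⟩
  have hM0 : redZero F (Fin n) M ≠ 0 := by
    rw [← hM, map_mul, map_mul]
    exact mul_ne_zero (mul_ne_zero hU0 hph) hQ0'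
  have hE0 : redZero F (Fin n) E ≠ 0 := by
    rw [← hE, map_mul, map_mul]
    exact mul_ne_zero (mul_ne_zero hV0 hqh) hP0'
  have hm : κ * (cU * cp * cQ) ≠ 0 := mul_ne_zero hκ (mul_ne_zero (mul_ne_zero hcU hcp) hcQ)
  have hd : cV * cq * cP ≠ 0 := mul_ne_zero (mul_ne_zero hcV hcq) hcP
  have hNum : C κ * U * p * PiQ =
      C (κ * (cU * cp * cQ)) * map (algebraMap F[X] (RatFunc F)) M := by
    rw [hUe, hpe, hQe, ← hM]
    simp only [map_mul]
    ring
  have hDen : V * q * PiP = C (cV * cq * cP) * map (algebraMap F[X] (RatFunc F)) E := by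
    rw [hVe, hqe, hPe, ← hE]
    simp only [map_mul]
    ring
  -- the cleared relation between the models, in `F(ε)(x)`
  have hrel' : T * (algebraMap (MvPolynomial (Fin n) (RatFunc F))
      (FractionRing (MvPolynomial (Fin n) (RatFunc F))) (C (cV * cq * cP)) * intToFrac F (Fin n) E) =
      algebraMap (MvPolynomial (Fin n) (RatFunc F))
        (FractionRing (MvPolynomial (Fin n) (RatFunc F))) (C (κ * (cU * cp * cQ))) *
        intToFrac F (Fin n) M := by
    rw [intToFrac_apply, intToFrac_apply, ← map_mul, ← map_mul, ← hNum, ← hDen]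
    exact hrel
  have hCd : algebraMap (MvPolynomial (Fin n) (RatFunc F))
      (FractionRing (MvPolynomial (Fin n) (RatFunc F))) (C (cV * cq * cP)) ≠ 0 :=
    (map_ne_zero_iff _ (IsFractionRing.injective _ _)).mpr (C_ne_zero.mpr hd)
  -- `T · ι(E) = ι(C (m/d) · M)`
  have hTE : T * intToFrac F (Fin n) E =
      algebraMap (MvPolynomial (Fin n) (RatFunc F))
        (FractionRing (MvPolynomial (Fin n) (RatFunc F)))
        (C (κ * (cU * cp * cQ) / (cV * cq * cP)) * map (algebraMap F[X] (RatFunc F)) M) := by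
    rw [map_mul, algebraMap_C_div, ← intToFrac_apply, div_mul_eq_mul_div, eq_div_iff hCd]
    calc T * intToFrac F (Fin n) E * algebraMap (MvPolynomial (Fin n) (RatFunc F))
          (FractionRing (MvPolynomial (Fin n) (RatFunc F))) (C (cV * cq * cP))
        = T * (algebraMap (MvPolynomial (Fin n) (RatFunc F))
            (FractionRing (MvPolynomial (Fin n) (RatFunc F))) (C (cV * cq * cP)) *
            intToFrac F (Fin n) E) := by ring
      _ = _ := hrel'
  -- the limit of `T · ι(E)` is `f · E(0)`
  have hlim : EpsLim (algebraMap (MvPolynomial (Fin n) (RatFunc F))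
      (FractionRing (MvPolynomial (Fin n) (RatFunc F)))
        (C (κ * (cU * cp * cQ) / (cV * cq * cP)) * map (algebraMap F[X] (RatFunc F)) M))
      (f * limToFrac F (Fin n) (redZero F (Fin n) E)) := by
    rw [← hTE]
    exact hT.mul (epsLim_intToFrac E)
  obtain ⟨u, hu, hu0⟩ := EpsLim.exists_eq_C_mul_of_normalForm (div_ne_zero hm hd) hM0 hlim
  refine ⟨u, cp, cq, ph, qh, hcp, hpe, hph, totalDegree_redZero_le_of_model hcp hpe,
    hcq, hqe, hqh, totalDegree_redZero_le_of_model hcq hqe, ?_, ?_, ?_, ?_⟩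
  · -- certificates for `(p̂, Π̂_P)`
    intro c hc
    obtain ⟨hPiP0, hPh0⟩ := coeff_zero_ne_zero_of_model hcP hPe hP0
    exact gcomp_model_mem_swsClass hcp hpe hPe hPiP0 hPh0 (hcertP c hc)
  · -- certificates for `(q̂, Π̂_Q)`
    intro c hc
    obtain ⟨hPiQ0, hQh0⟩ := coeff_zero_ne_zero_of_model hcQ hQe hQ0
    exact gcomp_model_mem_swsClass hcq hqe hQe hPiQ0 hQh0 (hcertQ c hc)
  · -- the residue identity
    have h1 : redZero F (Fin n) Vh * redZero F (Fin n) qh * redZero F (Fin n) Ph =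
        redZero F (Fin n) E := by rw [← hE, map_mul, map_mul]
    have h2 : redZero F (Fin n) Uh * redZero F (Fin n) ph * redZero F (Fin n) Qh =
        redZero F (Fin n) M := by rw [← hM, map_mul, map_mul]
    rw [h1, h2]
    exact hu
  · -- `u ≠ 0 ↔ f ≠ 0`
    constructor
    · intro hu' hf
      rw [hf, zero_mul, map_mul] at hu
      exact mul_ne_zero (limToFrac_ne_zero (C_ne_zero.mpr hu')) (limToFrac_ne_zero hM0) hu.symm
    · intro hf
      exact hu0 (mul_ne_zero hf (limToFrac_ne_zero hE0))

/-- **The order of the last term is nonnegative** ("it must happen that `val_ε(…) ≥ 0`",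
Claim 3.3 proof p0027 L733–735), for the exact term `T · (V q Π_P) = C κ U p Π_Q` as in
`deborder_exactTerm`: the total scalar `κ·c_U c_p c_{Π_Q}/(c_V c_q c_{Π_P})` of its `ε`-normal
form is `ε^{a} · p(ε)/q(ε)` with `p(0) q(0) ≠ 0`, `a : ℕ`. Stated for any normal form
`T · ι(E) = ι(C c · M)` with `M(0), E(0) ≠ 0`. [cite: DuttaDwivediSaxena2022, Claim 3.3 proof (full version p0027 L729–735)] -/
theorem exists_ord_of_epsLim_model {T : FractionRing (MvPolynomial (Fin n) (RatFunc F))}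
    {f : FractionRing (MvPolynomial (Fin n) F)} (hT : EpsLim T f) {c : RatFunc F} (hc : c ≠ 0)
    {M E : MvPolynomial (Fin n) F[X]} (hM : redZero F (Fin n) M ≠ 0)
    (hTE : T * intToFrac F (Fin n) E =
      algebraMap (MvPolynomial (Fin n) (RatFunc F)) (FractionRing (MvPolynomial (Fin n) (RatFunc F)))
        (C c * map (algebraMap F[X] (RatFunc F)) M)) :
    ∃ (a : ℕ) (p₁ q₁ : F[X]), p₁.coeff 0 ≠ 0 ∧ q₁.coeff 0 ≠ 0 ∧
      c * algebraMap F[X] (RatFunc F) q₁ = algebraMap F[X] (RatFunc F) (Polynomial.X ^ a * p₁) := by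
  have hlim : IsEpsInt (algebraMap (MvPolynomial (Fin n) (RatFunc F))
      (FractionRing (MvPolynomial (Fin n) (RatFunc F))) (C c * map (algebraMap F[X] (RatFunc F)) M)) := by
    rw [← hTE]
    exact (hT.mul (epsLim_intToFrac E)).isEpsInt
  exact IsEpsInt.exists_ord_of_normalForm hc hM hlim

end EndGame

/-! ## §4 The degenerate term -/

section Degenerate

variable {F : Type*} [Field F] {σ : Type*}

/-- A term that vanishes identically has limit `0` (the case `p = 0` excluded from
`deborder_exactTerm`: then `T = 0` and `f_{k−1} = 0`, computed by the empty ABP).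
[cite: DuttaDwivediSaxena2022, Claim 3.3 proof "then f = 0" (full version p0027 L733–735)] -/
theorem EpsLim.eq_zero_of_eq_zero {T : FractionRing (MvPolynomial σ (RatFunc F))}
    {f : FractionRing (MvPolynomial σ F)} (hT : EpsLim T f) (h0 : T = 0) : f = 0 := by
  rw [h0] at hT
  exact hT.unique epsLim_zero

end Degenerate


/-! # Part II (v2): from the residue identity to the top pair `f_{k−1} = N₀/D₀ ∈ ABP/ABP`

Appended after v1 landed (p562588). Contents, all PROVED, no definitions, no named facts:

* §5 `eq_truncate_mul_sum_gcomp`, `uabpComputes_of_gcomp` — graded reconstruction: a numerator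
  `p` with `deg p < N` is the degree-`< N` truncation of `Q · ∑_{c<N} gcomp p Q c`, hence has an
  ABP as soon as `Q` and the graded pieces do (toolkit `UABPComputes.sum/mul`,
  `UABPComputesLen.truncate`).
* §6 `uabp_residue_of_components` — the residue identity of `deborder_exactTerm` packaged as ONE
  fraction `N₀/D₀` with programs, given programs for the `ΠΣ` reductions and the graded pieces.
* §7 `exists_regularModel_formProd`, ★ `ExactTerm.deborder` — §1–§3 instantiated on brick B4b's
  data (`DDS21DiDILStep.lean`: `ExactTerm`, `formProd`, `FracPair.Cert`, `ExactTerm.val_mul_denPoly`).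
* §8 ★★ `ExactTerm.uabp_residue` — for a well-formed, `Σ∧Σ`-certified (`T.Cert N t`), size-`≤ B`
  (`T.Bdd B`, `B < N`) exact term with `ε`-regular form lists and `lim_{ε→0} T = f`:
  `f = N₀/D₀`, `D₀ ≠ 0`, both within an explicit polynomial budget in `(n, t, N, B)` — using
  `gcomp_redZero_mem_border` (`DDS21GradedFractionsEps.lean`, §C) and Lemma 2.23
  `uabpComputes_of_mem_border_swsClass` (`DDS21DeborderReadOnce.lean`) for the graded pieces and
  `uabpComputes_of_mem_spsClass` for the `ΠΣ` parts; the degenerate term `T = 0` gives `f = 0`.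
  This is "`\overline{Gen(1,·)} ⊆ ABP/ABP`" (Claim 3.3, full version p0027 L724–744) for the last
  DiDIL stage in the exact frame — the TOP input of the trace-back / final assembly
  (`DDS21TraceBackAssembly.lean`, `DDS21Thm32Assembly.lean`).

Honest framing as in Part I: `DDS2021_thm_3_2` / `DDS2021_thm_5_1` stay OPEN named facts; VP ≠ VNP
is NOT proved. -/

/-! ## §5 Graded reconstruction: a program for the numerator from its component certificates -/

section Reconstruction

variable {K : Type*} [Field K] {n : ℕ}

/-- **Graded reconstruction.** A polynomial `p` of total degree `< N` is the truncation below
degree `N` of `Q · ∑_{c<N} gcomp p Q c` (`Q(0) ≠ 0`): the numerator is recovered from the graded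
pieces of `p/Q` ("`P/Q` over `R_j = F[z]/(z^{d_j})`" read in the graded frame: `z`-coefficients are
homogeneous components, B4a `jet_mul_sum_gcomp`).
[cite: DuttaDwivediSaxena2022, §3 proof of Thm. 3.2, Φ and R_0 (full version p0028 L751–755); Claim 3.3 proof (p0027 L737–744)] -/
theorem eq_truncate_mul_sum_gcomp {p Q : MvPolynomial (Fin n) K} (hQ : coeff 0 Q ≠ 0) {N : ℕ}
    (hp : p.totalDegree < N) :
    p = ∑ k ∈ Finset.range N, homogeneousComponent k (Q * ∑ c ∈ Finset.range N, gcomp p Q c) := by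
  have h := jet_mul_sum_gcomp (p := p) hQ N
  rw [jet_coe_eq_self hp, jet_coe] at h
  exact h.symm

/-- **ABP for the numerator from ABPs for the graded pieces** (DDS Lemma 2.23's output assembled:
"`\overline{Σ∧Σ} ⊆ ARO ⊆ ABP`" componentwise, then one product with the `ΠΣ` denominator and one
degree truncation, toolkit `UABPComputes.sum/mul`, `UABPComputesLen.truncate`): if `Q` has a
program within budget `S₁`, every `gcomp p Q c` (`c < N`) one within `S₂ ≥ 2`, `Q(0) ≠ 0` and
`deg p < N`, then `p` has a program within `N·((S₁ + (N·2S₂ + 2))·N) + 2`.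
[cite: DuttaDwivediSaxena2022, Lemma 2.23 (full version p0025 L661–664); Claim 3.3 proof (p0027 L737–744)] -/
theorem uabpComputes_of_gcomp {p Q : MvPolynomial (Fin n) K} (hQ : coeff 0 Q ≠ 0) {N : ℕ}
    (hp : p.totalDegree < N) {S₁ S₂ : ℕ} (hS₂ : 2 ≤ S₂) (hQabp : UABPComputes S₁ Q)
    (hg : ∀ c < N, UABPComputes S₂ (gcomp p Q c)) :
    UABPComputes (N * ((S₁ + (N * (S₂ + S₂) + 2)) * N) + 2) p := by
  classical
  obtain ⟨D, rfl⟩ : ∃ D, N = D + 1 := ⟨N - 1, by omega⟩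
  have hS : UABPComputes ((D + 1) * (S₂ + S₂) + 2) (∑ c ∈ Finset.range (D + 1), gcomp p Q c) := by
    rw [Finset.sum_range]
    have h := UABPComputes.sum (ι := Fin (D + 1)) hS₂ (fun c => gcomp p Q (c : ℕ))
      fun c => hg c c.isLt
    simpa [Fintype.card_fin] using h
  obtain ⟨L, hprod⟩ := (hQabp.mul hS).exists_len
  have htr := (hprod.truncate D).uabpComputes
  rw [← eq_truncate_mul_sum_gcomp hQ hp] at htr
  exact htr

end Reconstruction

/-! ## §6 The residue as one fraction `N₀/D₀` of ABP-computed polynomials -/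

section ResiduePair

variable {F : Type*} [Field F] {n : ℕ}

/-- **The hand-over pair for `f_{k−1}`** ("`g_{k−1} ∈ Gen(1,·)` approximates `f_{k−1}` … `∈
ABP/ABP`", p0033 L891 – p0034 L897 with Claim 3.3): from the residue identity of
`deborder_exactTerm`, `f · (V̂₀ q̂₀ Π̂_{P,0}) = C u · (Û₀ p̂₀ Π̂_{Q,0})`, programs for the four `ΠΣ`
reductions (budget `S₁`), programs for the graded pieces `gcomp p̂₀ Π̂_{P,0} c`, `gcomp q̂₀ Π̂_{Q,0} c`
(`c < N`, budget `S₂ ≥ 2` — supplied downstream by `\overline{Σ∧Σ} ⊆ ABP`, Lemma 2.23) and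
`deg p̂₀, deg q̂₀ < N`: `f = N₀/D₀` with `D₀ ≠ 0` and both computed by ABPs with univariate labels
within an explicit polynomial budget.
[cite: DuttaDwivediSaxena2022, Claim 3.3 (full version p0027 L724–744); §3 end of the DiDIL induction (p0033 L891 – p0034 L897)] -/
theorem uabp_residue_of_components {f : FractionRing (MvPolynomial (Fin n) F)} {u : F}
    {U₀ V₀ P₀ Q₀ p₀ q₀ : MvPolynomial (Fin n) F}
    (hres : f * limToFrac F (Fin n) (V₀ * q₀ * P₀) = limToFrac F (Fin n) (C u * (U₀ * p₀ * Q₀)))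
    (hV0 : V₀ ≠ 0) (hq0 : q₀ ≠ 0) (hP00 : coeff 0 P₀ ≠ 0) (hQ00 : coeff 0 Q₀ ≠ 0)
    {N : ℕ} (hdp : p₀.totalDegree < N) (hdq : q₀.totalDegree < N)
    {S₁ S₂ : ℕ} (hS₂ : 2 ≤ S₂) (hU : UABPComputes S₁ U₀) (hV : UABPComputes S₁ V₀)
    (hP : UABPComputes S₁ P₀) (hQ : UABPComputes S₁ Q₀)
    (hgp : ∀ c < N, UABPComputes S₂ (gcomp p₀ P₀ c))
    (hgq : ∀ c < N, UABPComputes S₂ (gcomp q₀ Q₀ c)) :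
    ∃ N₀ D₀ : MvPolynomial (Fin n) F, D₀ ≠ 0 ∧
      f * limToFrac F (Fin n) D₀ = limToFrac F (Fin n) N₀ ∧
      UABPComputes (S₁ + (N * ((S₁ + (N * (S₂ + S₂) + 2)) * N) + 2) + S₁ + 2) N₀ ∧
      UABPComputes (S₁ + (N * ((S₁ + (N * (S₂ + S₂) + 2)) * N) + 2) + S₁ + 2) D₀ := by
  have hP0 : P₀ ≠ 0 := fun h => hP00 (by rw [h, coeff_zero])
  exact ⟨C u * (U₀ * p₀ * Q₀), V₀ * q₀ * P₀, mul_ne_zero (mul_ne_zero hV0 hq0) hP0, hres,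
    ((hU.mul (uabpComputes_of_gcomp hP00 hdp hS₂ hP hgp)).mul hQ).smul_C u,
    ((hV.mul (uabpComputes_of_gcomp hQ00 hdq hS₂ hQ hgq)).mul hP).mono (by omega)⟩

end ResiduePair

/-! ## §7 The end game on brick B4b's `ExactTerm` data -/

section ExactTermLevel

variable {F : Type*} [Field F] {n : ℕ}

/-- `ε`-regular `ΠΣ` products in B4b's list currency: if every form of `L` is `ε`-regular then
`formProd L = C c · ι(X̂)` with `X̂(ε=0) ∈ ΠΣ` over `F` (`|L|` factors) of nonzero constant term.
[cite: DuttaDwivediSaxena2022, §3 the map Φ (full version p0028 L751–754) and Claim 3.3 proof (p0027 L737–744)] -/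
theorem exists_regularModel_formProd (L : List (Option (Fin n) → RatFunc F))
    (hL : ∀ a ∈ L, ∃ (c : RatFunc F) (b : Option (Fin n) → F[X]), c ≠ 0 ∧
      (∀ o, a o = c * algebraMap F[X] (RatFunc F) (b o)) ∧ (b none).coeff 0 ≠ 0) :
    ∃ (c : RatFunc F) (Xh : MvPolynomial (Fin n) F[X]), c ≠ 0 ∧
      formProd L = C c * map (algebraMap F[X] (RatFunc F)) Xh ∧
      coeff 0 (redZero F (Fin n) Xh) ≠ 0 ∧ redZero F (Fin n) Xh ∈ spsClass F n 1 L.length := by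
  have e : formProd L = ∏ j : Fin L.length,
      (C ((L.get j) none) + ∑ m, C ((L.get j) (some m)) * X m) := by
    conv_lhs => rw [← List.ofFn_get L]
    rw [formProd_ofFn]
    rfl
  rw [e]
  exact exists_regularModel_prod_affine (fun j => L.get j) fun j => hL _ (List.get_mem L j)

/-- **The end game for an `ExactTerm`** (brick B4b's data `T = A·𝒫/𝒬` over `F(ε)`, well-formed
and nondegenerate, `Σ∧Σ`-certified below degree `N`, all four form lists `ε`-regular) with limit
`f`: the `ε`-normal forms of the two numerators, regular models of the four `ΠΣ` products, the
transferred certificates and the residue identity of `deborder_exactTerm`, in one statement (the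
input of the final assembly's top pair; Claim 3.3 at `j = k − 1`).
[cite: DuttaDwivediSaxena2022, Claim 3.3 with proof (full version p0027 L724–744); §3 end of the DiDIL induction (p0033 L891 – p0034 L897)] -/
theorem ExactTerm.deborder {T : ExactTerm (RatFunc F) n} (hWF : T.WF) (hND : T.ND) {N t : ℕ}
    (hcert : T.Cert N t)
    (hnum : ∀ a ∈ T.A.num, ∃ (c : RatFunc F) (b : Option (Fin n) → F[X]), c ≠ 0 ∧
      (∀ o, a o = c * algebraMap F[X] (RatFunc F) (b o)) ∧ (b none).coeff 0 ≠ 0)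
    (hden : ∀ a ∈ T.A.den, ∃ (c : RatFunc F) (b : Option (Fin n) → F[X]), c ≠ 0 ∧
      (∀ o, a o = c * algebraMap F[X] (RatFunc F) (b o)) ∧ (b none).coeff 0 ≠ 0)
    (hPL : ∀ a ∈ T.P.L, ∃ (c : RatFunc F) (b : Option (Fin n) → F[X]), c ≠ 0 ∧
      (∀ o, a o = c * algebraMap F[X] (RatFunc F) (b o)) ∧ (b none).coeff 0 ≠ 0)
    (hQL : ∀ a ∈ T.Q.L, ∃ (c : RatFunc F) (b : Option (Fin n) → F[X]), c ≠ 0 ∧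
      (∀ o, a o = c * algebraMap F[X] (RatFunc F) (b o)) ∧ (b none).coeff 0 ≠ 0)
    {f : FractionRing (MvPolynomial (Fin n) F)} (hT : EpsLim T.val f) :
    ∃ (u : F) (cp cq cU cV cP cQ : RatFunc F) (ph qh Uh Vh Ph Qh : MvPolynomial (Fin n) F[X]),
      (cp ≠ 0 ∧ T.P.p = C cp * map (algebraMap F[X] (RatFunc F)) ph ∧ redZero F (Fin n) ph ≠ 0 ∧
        (redZero F (Fin n) ph).totalDegree ≤ T.P.p.totalDegree) ∧
      (cq ≠ 0 ∧ T.Q.p = C cq * map (algebraMap F[X] (RatFunc F)) qh ∧ redZero F (Fin n) qh ≠ 0 ∧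
        (redZero F (Fin n) qh).totalDegree ≤ T.Q.p.totalDegree) ∧
      (cU ≠ 0 ∧ formProd T.A.num = C cU * map (algebraMap F[X] (RatFunc F)) Uh ∧
        coeff 0 (redZero F (Fin n) Uh) ≠ 0 ∧ redZero F (Fin n) Uh ∈ spsClass F n 1 T.A.num.length) ∧
      (cV ≠ 0 ∧ formProd T.A.den = C cV * map (algebraMap F[X] (RatFunc F)) Vh ∧
        coeff 0 (redZero F (Fin n) Vh) ≠ 0 ∧ redZero F (Fin n) Vh ∈ spsClass F n 1 T.A.den.length) ∧
      (cP ≠ 0 ∧ T.P.den = C cP * map (algebraMap F[X] (RatFunc F)) Ph ∧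
        coeff 0 (redZero F (Fin n) Ph) ≠ 0 ∧ redZero F (Fin n) Ph ∈ spsClass F n 1 T.P.L.length) ∧
      (cQ ≠ 0 ∧ T.Q.den = C cQ * map (algebraMap F[X] (RatFunc F)) Qh ∧
        coeff 0 (redZero F (Fin n) Qh) ≠ 0 ∧ redZero F (Fin n) Qh ∈ spsClass F n 1 T.Q.L.length) ∧
      (∀ c < N, gcomp (map (algebraMap F[X] (RatFunc F)) ph)
          (map (algebraMap F[X] (RatFunc F)) Ph) c ∈ swsClass (RatFunc F) n t c) ∧
      (∀ c < N, gcomp (map (algebraMap F[X] (RatFunc F)) qh)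
          (map (algebraMap F[X] (RatFunc F)) Qh) c ∈ swsClass (RatFunc F) n t c) ∧
      f * limToFrac F (Fin n) (redZero F (Fin n) Vh * redZero F (Fin n) qh * redZero F (Fin n) Ph) =
        limToFrac F (Fin n)
          (C u * (redZero F (Fin n) Uh * redZero F (Fin n) ph * redZero F (Fin n) Qh)) ∧
      (u ≠ 0 ↔ f ≠ 0) := by
  obtain ⟨cU, Uh, hcU, hUe, hU0, hUs⟩ := exists_regularModel_formProd T.A.num hnum
  obtain ⟨cV, Vh, hcV, hVe, hV0, hVs⟩ := exists_regularModel_formProd T.A.den hden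
  obtain ⟨cP, Ph, hcP, hPe, hP0, hPs⟩ := exists_regularModel_formProd T.P.L hPL
  obtain ⟨cQ, Qh, hcQ, hQe, hQ0, hQs⟩ := exists_regularModel_formProd T.Q.L hQL
  have hU0' : redZero F (Fin n) Uh ≠ 0 := fun h => hU0 (by rw [h, coeff_zero])
  have hV0' : redZero F (Fin n) Vh ≠ 0 := fun h => hV0 (by rw [h, coeff_zero])
  have hrel : T.val * algebraMap (MvPolynomial (Fin n) (RatFunc F))
      (FractionRing (MvPolynomial (Fin n) (RatFunc F))) (formProd T.A.den * T.Q.p * T.P.den) =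
      algebraMap (MvPolynomial (Fin n) (RatFunc F))
        (FractionRing (MvPolynomial (Fin n) (RatFunc F)))
        (C T.A.κ * formProd T.A.num * T.P.p * T.Q.den) :=
    T.val_mul_denPoly hWF
  have hPe' : T.P.den = C cP * map (algebraMap F[X] (RatFunc F)) Ph := hPe
  have hQe' : T.Q.den = C cQ * map (algebraMap F[X] (RatFunc F)) Qh := hQe
  obtain ⟨u, cp, cq, ph, qh, hcp, hpe, hph, hdp, hcq, hqe, hqh, hdq, hcP', hcQ', hres, hu⟩ :=
    deborder_exactTerm (e := fun c => c) hT T.A.hκ hcU hUe hU0' hcV hVe hV0' hcP hPe' hP0 hcQ hQe'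
      hQ0 hND hWF hrel (fun c hc => hcert.1 c hc) (fun c hc => hcert.2 c hc)
  exact ⟨u, cp, cq, cU, cV, cP, cQ, ph, qh, Uh, Vh, Ph, Qh, ⟨hcp, hpe, hph, hdp⟩, ⟨hcq, hqe, hqh, hdq⟩,
    ⟨hcU, hUe, hU0, hUs⟩, ⟨hcV, hVe, hV0, hVs⟩, ⟨hcP, hPe', hP0, hPs⟩, ⟨hcQ, hQe', hQ0, hQs⟩,
    hcP', hcQ', hres, hu⟩

end ExactTermLevel

/-! ## §8 The top pair `(N₀, D₀)` with ABPs: `\overline{Gen(1,·)} ⊆ ABP/ABP` at the last stage -/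

section TopPair

variable {F : Type*} [Field F] [CharZero F] {n : ℕ}

/-- Monotonicity of the `ΠΣ`-program budget in the number of factors. (folklore)
[cite: DuttaDwivediSaxena2022, §3 proof of Thm. 3.2, `k = 1` case (full version p0026 L716)] -/
theorem spsBudget_mono {D B : ℕ} (h : D ≤ B) :
    1 * (2 + D * ((n + 1) * 2 + 2)) + 2 ≤ 1 * (2 + B * ((n + 1) * 2 + 2)) + 2 := by
  have := Nat.mul_le_mul_right ((n + 1) * 2 + 2) h
  omega

/-- **DDS Thm. 3.2, last DiDIL stage: `f_{k−1} ∈ ABP/ABP` with explicit budgets** (Claim 3.3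
"`\overline{Gen(1,s)} ⊆ ABP/ABP`", p0027 L724–744, applied to the exact term of stage `k − 1`,
p0033 L891 – p0034 L897). For B4b's `T : ExactTerm F(ε) n` — well-formed, `Σ∧Σ`-certified below
degree `N` (`T.Cert N t`), of size `≤ B < N` (`T.Bdd B`), all form lists `ε`-regular — with
`lim_{ε→0} T = f`: `f = N₀/D₀` in `F(x)`, `D₀ ≠ 0`, and `N₀, D₀` are computed by ABPs with univariate
labels within the explicit polynomial budget below (`ΠΣ` parts: `uabpComputes_of_mem_spsClass`;
graded `Σ∧Σ` pieces: `gcomp_redZero_mem_border` + Lemma 2.23 `uabpComputes_of_mem_border_swsClass`;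
reassembly `uabp_residue_of_components`). The degenerate term (`¬ T.ND`, i.e. `T = 0`) gives `f = 0`.
[cite: DuttaDwivediSaxena2022, Claim 3.3 with proof (full version p0027 L724–744); Lemma 2.23 (p0025 L661–664); §3 end of the DiDIL induction (p0033 L891 – p0034 L897)] -/
theorem ExactTerm.uabp_residue {T : ExactTerm (RatFunc F) n} (hWF : T.WF) {N t B : ℕ}
    (hcert : T.Cert N t) (hB : T.Bdd B) (hBN : B < N)
    (hnum : ∀ a ∈ T.A.num, ∃ (c : RatFunc F) (b : Option (Fin n) → F[X]), c ≠ 0 ∧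
      (∀ o, a o = c * algebraMap F[X] (RatFunc F) (b o)) ∧ (b none).coeff 0 ≠ 0)
    (hden : ∀ a ∈ T.A.den, ∃ (c : RatFunc F) (b : Option (Fin n) → F[X]), c ≠ 0 ∧
      (∀ o, a o = c * algebraMap F[X] (RatFunc F) (b o)) ∧ (b none).coeff 0 ≠ 0)
    (hPL : ∀ a ∈ T.P.L, ∃ (c : RatFunc F) (b : Option (Fin n) → F[X]), c ≠ 0 ∧
      (∀ o, a o = c * algebraMap F[X] (RatFunc F) (b o)) ∧ (b none).coeff 0 ≠ 0)
    (hQL : ∀ a ∈ T.Q.L, ∃ (c : RatFunc F) (b : Option (Fin n) → F[X]), c ≠ 0 ∧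
      (∀ o, a o = c * algebraMap F[X] (RatFunc F) (b o)) ∧ (b none).coeff 0 ≠ 0)
    {f : FractionRing (MvPolynomial (Fin n) F)} (hT : EpsLim T.val f) :
    ∃ N₀ D₀ : MvPolynomial (Fin n) F, D₀ ≠ 0 ∧
      f * limToFrac F (Fin n) D₀ = limToFrac F (Fin n) N₀ ∧
      UABPComputes ((1 * (2 + B * ((n + 1) * 2 + 2)) + 2) +
        (N * (((1 * (2 + B * ((n + 1) * 2 + 2)) + 2) +
          (N * (((n + 1) * (t * ((n + 1) * N + 1)) + N + 2) +
            ((n + 1) * (t * ((n + 1) * N + 1)) + N + 2)) + 2)) * N) + 2) +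
        (1 * (2 + B * ((n + 1) * 2 + 2)) + 2) + 2) N₀ ∧
      UABPComputes ((1 * (2 + B * ((n + 1) * 2 + 2)) + 2) +
        (N * (((1 * (2 + B * ((n + 1) * 2 + 2)) + 2) +
          (N * (((n + 1) * (t * ((n + 1) * N + 1)) + N + 2) +
            ((n + 1) * (t * ((n + 1) * N + 1)) + N + 2)) + 2)) * N) + 2) +
        (1 * (2 + B * ((n + 1) * 2 + 2)) + 2) + 2) D₀ := by
  obtain ⟨hB1, hB2, hB3, hB4, hB5, hB6⟩ := hB
  by_cases hND : T.ND
  · obtain ⟨u, cp, cq, cU, cV, cP, cQ, ph, qh, Uh, Vh, Ph, Qh, ⟨-, -, hph, hdp⟩, ⟨-, -, hqh, hdq⟩,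
      ⟨-, -, hU0, hUs⟩, ⟨-, -, hV0, hVs⟩, ⟨-, -, hP0, hPs⟩, ⟨-, -, hQ0, hQs⟩, hcP, hcQ, hres, -⟩ :=
      ExactTerm.deborder hWF hND hcert hnum hden hPL hQL hT
    have hV0' : redZero F (Fin n) Vh ≠ 0 := fun h => hV0 (by rw [h, coeff_zero])
    -- programs for the four `ΠΣ` reductions, within the common budget for `≤ B` factors
    have hUa := (uabpComputes_of_mem_spsClass hUs).mono (spsBudget_mono (n := n) hB1)
    have hVa := (uabpComputes_of_mem_spsClass hVs).mono (spsBudget_mono (n := n) hB2)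
    have hPa := (uabpComputes_of_mem_spsClass hPs).mono (spsBudget_mono (n := n) hB4)
    have hQa := (uabpComputes_of_mem_spsClass hQs).mono (spsBudget_mono (n := n) hB6)
    -- programs for the graded pieces: de-border (`gcomp_redZero_mem_border`), then Lemma 2.23
    have hgp : ∀ c < N, UABPComputes ((n + 1) * (t * ((n + 1) * N + 1)) + N + 2)
        (gcomp (redZero F (Fin n) ph) (redZero F (Fin n) Ph) c) := fun c hc =>
      uabpComputes_of_mem_border_swsClass
        (border_mono (swsClass_mono le_rfl hc.le) (gcomp_redZero_mem_border hP0 (hcP c hc)))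
    have hgq : ∀ c < N, UABPComputes ((n + 1) * (t * ((n + 1) * N + 1)) + N + 2)
        (gcomp (redZero F (Fin n) qh) (redZero F (Fin n) Qh) c) := fun c hc =>
      uabpComputes_of_mem_border_swsClass
        (border_mono (swsClass_mono le_rfl hc.le) (gcomp_redZero_mem_border hQ0 (hcQ c hc)))
    exact uabp_residue_of_components hres hV0' hqh hP0 hQ0 (lt_of_le_of_lt hdp (lt_of_le_of_lt hB3 hBN))
      (lt_of_le_of_lt hdq (lt_of_le_of_lt hB5 hBN)) (by omega) hUa hVa hPa hQa hgp hgq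
  · -- the degenerate term: `T = 0`, `f = 0 = 0/1`
    have hf : f = 0 := hT.eq_zero_of_eq_zero ((T.val_eq_zero_iff hWF).mpr hND)
    refine ⟨0, 1, one_ne_zero, by rw [hf, zero_mul, map_zero], ?_, ?_⟩
    · exact (UABPComputesLen.zero (by omega) 0).uabpComputes
    · have h := (UABPComputesLen.of_C (n := n) (S := 2) le_rfl (1 : F)).uabpComputes
      rw [C_1] at h
      exact h.mono (by omega)

/-- **The top pair with DEGREE BOUNDS** (`ExactTerm.uabp_residue` refined): the witnesses are
`N₀ = C u · Û(0) p̂(0) Π̂_Q(0)`, `D₀ = V̂(0) q̂(0) Π̂_P(0)`, so `deg N₀, deg D₀ ≤ 3B` for a size-`≤ B`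
term (each `ΠΣ` reduction has degree `≤` its number of forms, `totalDegree_le_of_mem_spsClass`;
`deg p̂(0) ≤ deg p ≤ B`) — the degree data the trace-back's top seam consumes
(`DDS21TranscriptDilation.exists_top_pair`: `hdN`, `hdD`).
[cite: DuttaDwivediSaxena2022, Claim 3.3 with proof (full version p0027 L724–744); Claim 3.6 degree recursion (p0033 L880–887)] -/
theorem ExactTerm.uabp_residue_deg {T : ExactTerm (RatFunc F) n} (hWF : T.WF) {N t B : ℕ}
    (hcert : T.Cert N t) (hB : T.Bdd B) (hBN : B < N)
    (hnum : ∀ a ∈ T.A.num, ∃ (c : RatFunc F) (b : Option (Fin n) → F[X]), c ≠ 0 ∧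
      (∀ o, a o = c * algebraMap F[X] (RatFunc F) (b o)) ∧ (b none).coeff 0 ≠ 0)
    (hden : ∀ a ∈ T.A.den, ∃ (c : RatFunc F) (b : Option (Fin n) → F[X]), c ≠ 0 ∧
      (∀ o, a o = c * algebraMap F[X] (RatFunc F) (b o)) ∧ (b none).coeff 0 ≠ 0)
    (hPL : ∀ a ∈ T.P.L, ∃ (c : RatFunc F) (b : Option (Fin n) → F[X]), c ≠ 0 ∧
      (∀ o, a o = c * algebraMap F[X] (RatFunc F) (b o)) ∧ (b none).coeff 0 ≠ 0)
    (hQL : ∀ a ∈ T.Q.L, ∃ (c : RatFunc F) (b : Option (Fin n) → F[X]), c ≠ 0 ∧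
      (∀ o, a o = c * algebraMap F[X] (RatFunc F) (b o)) ∧ (b none).coeff 0 ≠ 0)
    {f : FractionRing (MvPolynomial (Fin n) F)} (hT : EpsLim T.val f) :
    ∃ N₀ D₀ : MvPolynomial (Fin n) F, D₀ ≠ 0 ∧
      f * limToFrac F (Fin n) D₀ = limToFrac F (Fin n) N₀ ∧
      UABPComputes ((1 * (2 + B * ((n + 1) * 2 + 2)) + 2) +
        (N * (((1 * (2 + B * ((n + 1) * 2 + 2)) + 2) +
          (N * (((n + 1) * (t * ((n + 1) * N + 1)) + N + 2) +
            ((n + 1) * (t * ((n + 1) * N + 1)) + N + 2)) + 2)) * N) + 2) +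
        (1 * (2 + B * ((n + 1) * 2 + 2)) + 2) + 2) N₀ ∧
      UABPComputes ((1 * (2 + B * ((n + 1) * 2 + 2)) + 2) +
        (N * (((1 * (2 + B * ((n + 1) * 2 + 2)) + 2) +
          (N * (((n + 1) * (t * ((n + 1) * N + 1)) + N + 2) +
            ((n + 1) * (t * ((n + 1) * N + 1)) + N + 2)) + 2)) * N) + 2) +
        (1 * (2 + B * ((n + 1) * 2 + 2)) + 2) + 2) D₀ ∧
      N₀.totalDegree ≤ 3 * B ∧ D₀.totalDegree ≤ 3 * B := by
  obtain ⟨hB1, hB2, hB3, hB4, hB5, hB6⟩ := hB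
  by_cases hND : T.ND
  · obtain ⟨u, cp, cq, cU, cV, cP, cQ, ph, qh, Uh, Vh, Ph, Qh, ⟨-, -, hph, hdp⟩, ⟨-, -, hqh, hdq⟩,
      ⟨-, -, hU0, hUs⟩, ⟨-, -, hV0, hVs⟩, ⟨-, -, hP0, hPs⟩, ⟨-, -, hQ0, hQs⟩, hcP, hcQ, hres, -⟩ :=
      ExactTerm.deborder hWF hND hcert hnum hden hPL hQL hT
    have hV0' : redZero F (Fin n) Vh ≠ 0 := fun h => hV0 (by rw [h, coeff_zero])
    have hP0' : redZero F (Fin n) Ph ≠ 0 := fun h => hP0 (by rw [h, coeff_zero])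
    have hUa := (uabpComputes_of_mem_spsClass hUs).mono (spsBudget_mono (n := n) hB1)
    have hVa := (uabpComputes_of_mem_spsClass hVs).mono (spsBudget_mono (n := n) hB2)
    have hPa := (uabpComputes_of_mem_spsClass hPs).mono (spsBudget_mono (n := n) hB4)
    have hQa := (uabpComputes_of_mem_spsClass hQs).mono (spsBudget_mono (n := n) hB6)
    have hgp : ∀ c < N, UABPComputes ((n + 1) * (t * ((n + 1) * N + 1)) + N + 2)
        (gcomp (redZero F (Fin n) ph) (redZero F (Fin n) Ph) c) := fun c hc =>
      uabpComputes_of_mem_border_swsClass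
        (border_mono (swsClass_mono le_rfl hc.le) (gcomp_redZero_mem_border hP0 (hcP c hc)))
    have hgq : ∀ c < N, UABPComputes ((n + 1) * (t * ((n + 1) * N + 1)) + N + 2)
        (gcomp (redZero F (Fin n) qh) (redZero F (Fin n) Qh) c) := fun c hc =>
      uabpComputes_of_mem_border_swsClass
        (border_mono (swsClass_mono le_rfl hc.le) (gcomp_redZero_mem_border hQ0 (hcQ c hc)))
    have hpa := uabpComputes_of_gcomp hP0 (lt_of_le_of_lt hdp (lt_of_le_of_lt hB3 hBN))
      (by omega) hPa hgp
    have hqa := uabpComputes_of_gcomp hQ0 (lt_of_le_of_lt hdq (lt_of_le_of_lt hB5 hBN))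
      (by omega) hQa hgq
    -- degrees
    have dU := (totalDegree_le_of_mem_spsClass hUs).trans hB1
    have dV := (totalDegree_le_of_mem_spsClass hVs).trans hB2
    have dP := (totalDegree_le_of_mem_spsClass hPs).trans hB4
    have dQ := (totalDegree_le_of_mem_spsClass hQs).trans hB6
    have dp := hdp.trans hB3
    have dq := hdq.trans hB5
    refine ⟨C u * (redZero F (Fin n) Uh * redZero F (Fin n) ph * redZero F (Fin n) Qh),
      redZero F (Fin n) Vh * redZero F (Fin n) qh * redZero F (Fin n) Ph,
      mul_ne_zero (mul_ne_zero hV0' hqh) hP0', hres, ((hUa.mul hpa).mul hQa).smul_C u,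
      ((hVa.mul hqa).mul hPa).mono (by omega), ?_, ?_⟩
    · refine (totalDegree_mul _ _).trans ?_
      rw [totalDegree_C, zero_add]
      refine (totalDegree_mul _ _).trans ?_
      have h1 := totalDegree_mul (redZero F (Fin n) Uh) (redZero F (Fin n) ph)
      omega
    · refine (totalDegree_mul _ _).trans ?_
      have h1 := totalDegree_mul (redZero F (Fin n) Vh) (redZero F (Fin n) qh)
      omega
  · have hf : f = 0 := hT.eq_zero_of_eq_zero ((T.val_eq_zero_iff hWF).mpr hND)
    refine ⟨0, 1, one_ne_zero, by rw [hf, zero_mul, map_zero], ?_, ?_, ?_, ?_⟩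
    · exact (UABPComputesLen.zero (by omega) 0).uabpComputes
    · have h := (UABPComputesLen.of_C (n := n) (S := 2) le_rfl (1 : F)).uabpComputes
      rw [C_1] at h
      exact h.mono (by omega)
    · rw [totalDegree_zero]; exact Nat.zero_le _
    · rw [totalDegree_one]; exact Nat.zero_le _

/-- **The top pair from the SCALED last term** (the exit shape of brick (E2)'s
`isEpsInt_scaled_last_term` / `epsLim_chain_of_scaledRaw`: after the rounds one raw term `T`
remains and `λ · T`, `λ ∈ F(ε)^×`, tends to `f_{k−1}`): absorb the scalar into the term's `κ`
(`ExactTerm.smul`, which keeps `𝒫`, `𝒬`, all form lists, `Cert`, `Bdd`) and apply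
`ExactTerm.uabp_residue`. [cite: DuttaDwivediSaxena2022, Claim 3.3 with proof (full version p0027 L724–744); §3 end of the DiDIL induction (p0033 L891 – p0034 L897)] -/
theorem ExactTerm.uabp_residue_scaled {T : ExactTerm (RatFunc F) n} (hWF : T.WF) {N t B : ℕ}
    (hcert : T.Cert N t) (hB : T.Bdd B) (hBN : B < N)
    (hnum : ∀ a ∈ T.A.num, ∃ (c : RatFunc F) (b : Option (Fin n) → F[X]), c ≠ 0 ∧
      (∀ o, a o = c * algebraMap F[X] (RatFunc F) (b o)) ∧ (b none).coeff 0 ≠ 0)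
    (hden : ∀ a ∈ T.A.den, ∃ (c : RatFunc F) (b : Option (Fin n) → F[X]), c ≠ 0 ∧
      (∀ o, a o = c * algebraMap F[X] (RatFunc F) (b o)) ∧ (b none).coeff 0 ≠ 0)
    (hPL : ∀ a ∈ T.P.L, ∃ (c : RatFunc F) (b : Option (Fin n) → F[X]), c ≠ 0 ∧
      (∀ o, a o = c * algebraMap F[X] (RatFunc F) (b o)) ∧ (b none).coeff 0 ≠ 0)
    (hQL : ∀ a ∈ T.Q.L, ∃ (c : RatFunc F) (b : Option (Fin n) → F[X]), c ≠ 0 ∧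
      (∀ o, a o = c * algebraMap F[X] (RatFunc F) (b o)) ∧ (b none).coeff 0 ≠ 0)
    {c : RatFunc F} (hc : c ≠ 0) {f : FractionRing (MvPolynomial (Fin n) F)}
    (hT : EpsLim (algebraMap (RatFunc F) (FractionRing (MvPolynomial (Fin n) (RatFunc F))) c *
      T.val) f) :
    ∃ N₀ D₀ : MvPolynomial (Fin n) F, D₀ ≠ 0 ∧
      f * limToFrac F (Fin n) D₀ = limToFrac F (Fin n) N₀ ∧
      UABPComputes ((1 * (2 + B * ((n + 1) * 2 + 2)) + 2) +
        (N * (((1 * (2 + B * ((n + 1) * 2 + 2)) + 2) +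
          (N * (((n + 1) * (t * ((n + 1) * N + 1)) + N + 2) +
            ((n + 1) * (t * ((n + 1) * N + 1)) + N + 2)) + 2)) * N) + 2) +
        (1 * (2 + B * ((n + 1) * 2 + 2)) + 2) + 2) N₀ ∧
      UABPComputes ((1 * (2 + B * ((n + 1) * 2 + 2)) + 2) +
        (N * (((1 * (2 + B * ((n + 1) * 2 + 2)) + 2) +
          (N * (((n + 1) * (t * ((n + 1) * N + 1)) + N + 2) +
            ((n + 1) * (t * ((n + 1) * N + 1)) + N + 2)) + 2)) * N) + 2) +
        (1 * (2 + B * ((n + 1) * 2 + 2)) + 2) + 2) D₀ ∧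
      N₀.totalDegree ≤ 3 * B ∧ D₀.totalDegree ≤ 3 * B := by
  have hval : (T.smul c hc).val =
      algebraMap (RatFunc F) (FractionRing (MvPolynomial (Fin n) (RatFunc F))) c * T.val := by
    rw [ExactTerm.val_smul, IsScalarTower.algebraMap_apply (RatFunc F)
      (MvPolynomial (Fin n) (RatFunc F)) (FractionRing (MvPolynomial (Fin n) (RatFunc F))),
      MvPolynomial.algebraMap_eq]
  rw [← hval] at hT
  exact ExactTerm.uabp_residue_deg (T := T.smul c hc) hWF (ExactTerm.Cert.smul c hc hcert)
    (ExactTerm.bdd_smul c hc hB) hBN hnum hden hPL hQL hT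

end TopPair

/-! ## §9 One-parameter budgets: the top pair within `s ^ 10` -/

section OneParameter

variable {F : Type*} [Field F] [CharZero F] {n : ℕ}

/-- The explicit top-pair budget of `ExactTerm.uabp_residue` is at most `s ^ 10` for any `s ≥ 2`
dominating `n + 1`, `t`, `N`, `B` (crude; the exponent is immaterial — it is absorbed into the
`s ^ (c·k·7^k)` of `DDS2021_thm_3_2`, "size `s^{O(k·7^k)}`", Thm. 3.2).
[cite: DuttaDwivediSaxena2022, Thm. 3.2 statement (full version p0026 L713–715); Claim 3.6 size recursion (p0033 L886–890)] -/
theorem endGameBudget_le_pow {n t N B s : ℕ} (hs : 2 ≤ s) (hn : n + 1 ≤ s) (ht : t ≤ s)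
    (hN : N ≤ s) (hB : B ≤ s) :
    (1 * (2 + B * ((n + 1) * 2 + 2)) + 2) +
        (N * (((1 * (2 + B * ((n + 1) * 2 + 2)) + 2) +
          (N * (((n + 1) * (t * ((n + 1) * N + 1)) + N + 2) +
            ((n + 1) * (t * ((n + 1) * N + 1)) + N + 2)) + 2)) * N) + 2) +
        (1 * (2 + B * ((n + 1) * 2 + 2)) + 2) + 2 ≤ s ^ 10 := by
  -- power atoms
  obtain ⟨P2, hP2⟩ : ∃ P2, P2 = s * s := ⟨_, rfl⟩
  obtain ⟨P4, hP4⟩ : ∃ P4, P4 = P2 * P2 := ⟨_, rfl⟩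
  obtain ⟨P5, hP5⟩ : ∃ P5, P5 = P4 * s := ⟨_, rfl⟩
  obtain ⟨P7, hP7⟩ : ∃ P7, P7 = P5 * P2 := ⟨_, rfl⟩
  have e10 : s ^ 10 = P7 * P2 * s := by subst hP2 hP4 hP5 hP7; ring
  have h2s : 2 * s ≤ P2 := hP2 ▸ Nat.mul_le_mul_right s hs
  have h4 : 4 ≤ P2 := le_trans (by omega) h2s
  have hsP2 : s ≤ P2 := le_trans (by omega) h2s
  have hP4ge : 4 * P2 ≤ P4 := hP4 ▸ Nat.mul_le_mul_right P2 h4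
  have hP5ge : 8 * P2 ≤ P5 := by
    rw [hP5]; calc 8 * P2 = 4 * P2 * 2 := by ring
      _ ≤ P4 * s := Nat.mul_le_mul hP4ge hs
  have hP7ge : 32 * P2 ≤ P7 := by
    rw [hP7]; calc 32 * P2 = 8 * 4 * P2 := by ring
      _ ≤ 8 * P2 * P2 := by nlinarith
      _ ≤ P5 * P2 := Nat.mul_le_mul_right P2 hP5ge
  have hP10ge : 8 * P7 ≤ P7 * P2 * s := by
    calc 8 * P7 = P7 * 4 * 2 := by ring
      _ ≤ P7 * P2 * s := Nat.mul_le_mul (Nat.mul_le_mul_left P7 h4) hs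
  -- (a) the ΠΣ budget
  set S₁ := 1 * (2 + B * ((n + 1) * 2 + 2)) + 2 with hS₁
  have ha : S₁ ≤ 5 * P2 := by
    have h1 : B * ((n + 1) * 2 + 2) ≤ s * (s * 2 + 2) := Nat.mul_le_mul hB (by omega)
    have h2 : s * (s * 2 + 2) = 2 * P2 + 2 * s := by rw [hP2]; ring
    omega
  -- (b) the Σ∧Σ-piece budget
  set S₂ := (n + 1) * (t * ((n + 1) * N + 1)) + N + 2 with hS₂
  have hb : S₂ ≤ 2 * P4 := by
    have h1 : (n + 1) * N ≤ P2 := hP2 ▸ Nat.mul_le_mul hn hN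
    have h2 : (n + 1) * (t * ((n + 1) * N + 1)) ≤ s * (s * (P2 + 1)) :=
      Nat.mul_le_mul hn (Nat.mul_le_mul ht (by omega))
    have h3 : s * (s * (P2 + 1)) = P4 + P2 := by rw [hP4, hP2]; ring
    omega
  -- (c) inner sum
  have hc : S₁ + (N * (S₂ + S₂) + 2) ≤ 6 * P5 := by
    have h1 : N * (S₂ + S₂) ≤ s * (4 * P4) := Nat.mul_le_mul hN (by omega)
    have h2 : s * (4 * P4) = 4 * P5 := by rw [hP5]; ring
    omega
  -- (d) middle term
  have hd : N * ((S₁ + (N * (S₂ + S₂) + 2)) * N) ≤ 6 * P7 := by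
    have h1 : N * ((S₁ + (N * (S₂ + S₂) + 2)) * N) ≤ s * (6 * P5 * s) :=
      Nat.mul_le_mul hN (Nat.mul_le_mul hc hN)
    have h2 : s * (6 * P5 * s) = 6 * P7 := by rw [hP7, hP2]; ring
    omega
  -- (e)+(f)
  rw [e10]
  omega

/-- Degrees `≤ 3B ≤ 3s` are within `s ^ 10` for `s ≥ 2`. (folklore)
[cite: DuttaDwivediSaxena2022, Thm. 3.2 statement (full version p0026 L713–715)] -/
theorem three_mul_le_pow {B s : ℕ} (hs : 2 ≤ s) (hB : B ≤ s) : 3 * B ≤ s ^ 10 := by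
  have h2 : 2 * s ≤ s * s := Nat.mul_le_mul_right s hs
  have h3 : 2 * (s * s) ≤ s * (s * s) := Nat.mul_le_mul_right (s * s) hs
  have h1 : 3 * B ≤ s * (s * s) := by omega
  calc 3 * B ≤ s * (s * s) := h1
    _ = s ^ 3 := by ring
    _ ≤ s ^ 10 := Nat.pow_le_pow_right (by omega) (by norm_num)

/-- **Top pair within `s ^ 10`** (one-parameter form of `ExactTerm.uabp_residue_deg`, in the binder
shape of `DDS2021_thm_3_2`: `2 ≤ s`, `n + 1, t, N, B ≤ s`).
[cite: DuttaDwivediSaxena2022, Claim 3.3 with proof (full version p0027 L724–744); Thm. 3.2 (p0026 L713–715)] -/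
theorem ExactTerm.uabp_residue_le {T : ExactTerm (RatFunc F) n} (hWF : T.WF) {N t B s : ℕ}
    (hcert : T.Cert N t) (hB : T.Bdd B) (hBN : B < N)
    (hnum : ∀ a ∈ T.A.num, ∃ (c : RatFunc F) (b : Option (Fin n) → F[X]), c ≠ 0 ∧
      (∀ o, a o = c * algebraMap F[X] (RatFunc F) (b o)) ∧ (b none).coeff 0 ≠ 0)
    (hden : ∀ a ∈ T.A.den, ∃ (c : RatFunc F) (b : Option (Fin n) → F[X]), c ≠ 0 ∧
      (∀ o, a o = c * algebraMap F[X] (RatFunc F) (b o)) ∧ (b none).coeff 0 ≠ 0)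
    (hPL : ∀ a ∈ T.P.L, ∃ (c : RatFunc F) (b : Option (Fin n) → F[X]), c ≠ 0 ∧
      (∀ o, a o = c * algebraMap F[X] (RatFunc F) (b o)) ∧ (b none).coeff 0 ≠ 0)
    (hQL : ∀ a ∈ T.Q.L, ∃ (c : RatFunc F) (b : Option (Fin n) → F[X]), c ≠ 0 ∧
      (∀ o, a o = c * algebraMap F[X] (RatFunc F) (b o)) ∧ (b none).coeff 0 ≠ 0)
    (hs : 2 ≤ s) (hn : n + 1 ≤ s) (ht : t ≤ s) (hNs : N ≤ s) (hBs : B ≤ s)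
    {f : FractionRing (MvPolynomial (Fin n) F)} (hT : EpsLim T.val f) :
    ∃ N₀ D₀ : MvPolynomial (Fin n) F, D₀ ≠ 0 ∧
      f * limToFrac F (Fin n) D₀ = limToFrac F (Fin n) N₀ ∧
      UABPComputes (s ^ 10) N₀ ∧ UABPComputes (s ^ 10) D₀ ∧
      N₀.totalDegree ≤ s ^ 10 ∧ D₀.totalDegree ≤ s ^ 10 := by
  obtain ⟨N₀, D₀, hD, hf, hN, hD', hdN, hdD⟩ :=
    ExactTerm.uabp_residue_deg hWF hcert hB hBN hnum hden hPL hQL hT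
  have h3 : 3 * B ≤ s ^ 10 := three_mul_le_pow hs hBs
  exact ⟨N₀, D₀, hD, hf, hN.mono (endGameBudget_le_pow hs hn ht hNs hBs),
    hD'.mono (endGameBudget_le_pow hs hn ht hNs hBs), hdN.trans h3, hdD.trans h3⟩

/-- **Top pair within `s ^ 10`, scaled last term** (one-parameter form of
`ExactTerm.uabp_residue_scaled`). [cite: DuttaDwivediSaxena2022, Claim 3.3 with proof (full version p0027 L724–744); Thm. 3.2 (p0026 L713–715)] -/
theorem ExactTerm.uabp_residue_scaled_le {T : ExactTerm (RatFunc F) n} (hWF : T.WF)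
    {N t B s : ℕ} (hcert : T.Cert N t) (hB : T.Bdd B) (hBN : B < N)
    (hnum : ∀ a ∈ T.A.num, ∃ (c : RatFunc F) (b : Option (Fin n) → F[X]), c ≠ 0 ∧
      (∀ o, a o = c * algebraMap F[X] (RatFunc F) (b o)) ∧ (b none).coeff 0 ≠ 0)
    (hden : ∀ a ∈ T.A.den, ∃ (c : RatFunc F) (b : Option (Fin n) → F[X]), c ≠ 0 ∧
      (∀ o, a o = c * algebraMap F[X] (RatFunc F) (b o)) ∧ (b none).coeff 0 ≠ 0)
    (hPL : ∀ a ∈ T.P.L, ∃ (c : RatFunc F) (b : Option (Fin n) → F[X]), c ≠ 0 ∧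
      (∀ o, a o = c * algebraMap F[X] (RatFunc F) (b o)) ∧ (b none).coeff 0 ≠ 0)
    (hQL : ∀ a ∈ T.Q.L, ∃ (c : RatFunc F) (b : Option (Fin n) → F[X]), c ≠ 0 ∧
      (∀ o, a o = c * algebraMap F[X] (RatFunc F) (b o)) ∧ (b none).coeff 0 ≠ 0)
    (hs : 2 ≤ s) (hn : n + 1 ≤ s) (ht : t ≤ s) (hNs : N ≤ s) (hBs : B ≤ s)
    {c : RatFunc F} (hc : c ≠ 0) {f : FractionRing (MvPolynomial (Fin n) F)}
    (hT : EpsLim (algebraMap (RatFunc F) (FractionRing (MvPolynomial (Fin n) (RatFunc F))) c *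
      T.val) f) :
    ∃ N₀ D₀ : MvPolynomial (Fin n) F, D₀ ≠ 0 ∧
      f * limToFrac F (Fin n) D₀ = limToFrac F (Fin n) N₀ ∧
      UABPComputes (s ^ 10) N₀ ∧ UABPComputes (s ^ 10) D₀ ∧
      N₀.totalDegree ≤ s ^ 10 ∧ D₀.totalDegree ≤ s ^ 10 := by
  obtain ⟨N₀, D₀, hD, hf, hN, hD', hdN, hdD⟩ :=
    ExactTerm.uabp_residue_scaled hWF hcert hB hBN hnum hden hPL hQL hc hT
  have h3 : 3 * B ≤ s ^ 10 := three_mul_le_pow hs hBs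
  exact ⟨N₀, D₀, hD, hf, hN.mono (endGameBudget_le_pow hs hn ht hNs hBs),
    hD'.mono (endGameBudget_le_pow hs hn ht hNs hBs), hdN.trans h3, hdD.trans h3⟩

end OneParameter

/-! ## §10 The same with brick B4b's `FormsSat` (form lists ε-regular, one hypothesis) -/

section FormsSatWrappers

variable {F : Type*} [Field F] [CharZero F] {n : ℕ}

/-- `ExactTerm.uabp_residue_deg` with the four regularity hypotheses bundled as
`T.FormsSat (ε-regular)` (brick B4b v3: `FormsSat`, transported along the rounds by
`formsSat_didilIter` from `exists_stageZero_forall` + `forall_exists_regular_of_generic_shift`).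
[cite: DuttaDwivediSaxena2022, Claim 3.3 with proof (full version p0027 L724–744); §3 end of the DiDIL induction (p0033 L891 – p0034 L897)] -/
theorem ExactTerm.uabp_residue_deg_of_formsSat {T : ExactTerm (RatFunc F) n} (hWF : T.WF)
    {N t B : ℕ} (hcert : T.Cert N t) (hB : T.Bdd B) (hBN : B < N)
    (hreg : T.FormsSat fun a => ∃ (c : RatFunc F) (b : Option (Fin n) → F[X]), c ≠ 0 ∧
      (∀ o, a o = c * algebraMap F[X] (RatFunc F) (b o)) ∧ (b none).coeff 0 ≠ 0)
    {f : FractionRing (MvPolynomial (Fin n) F)} (hT : EpsLim T.val f) :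
    ∃ N₀ D₀ : MvPolynomial (Fin n) F, D₀ ≠ 0 ∧
      f * limToFrac F (Fin n) D₀ = limToFrac F (Fin n) N₀ ∧
      UABPComputes ((1 * (2 + B * ((n + 1) * 2 + 2)) + 2) +
        (N * (((1 * (2 + B * ((n + 1) * 2 + 2)) + 2) +
          (N * (((n + 1) * (t * ((n + 1) * N + 1)) + N + 2) +
            ((n + 1) * (t * ((n + 1) * N + 1)) + N + 2)) + 2)) * N) + 2) +
        (1 * (2 + B * ((n + 1) * 2 + 2)) + 2) + 2) N₀ ∧
      UABPComputes ((1 * (2 + B * ((n + 1) * 2 + 2)) + 2) +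
        (N * (((1 * (2 + B * ((n + 1) * 2 + 2)) + 2) +
          (N * (((n + 1) * (t * ((n + 1) * N + 1)) + N + 2) +
            ((n + 1) * (t * ((n + 1) * N + 1)) + N + 2)) + 2)) * N) + 2) +
        (1 * (2 + B * ((n + 1) * 2 + 2)) + 2) + 2) D₀ ∧
      N₀.totalDegree ≤ 3 * B ∧ D₀.totalDegree ≤ 3 * B :=
  ExactTerm.uabp_residue_deg hWF hcert hB hBN hreg.1 hreg.2.1 hreg.2.2.1 hreg.2.2.2 hT

/-- `ExactTerm.uabp_residue_le` with `T.FormsSat (ε-regular)`.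
[cite: DuttaDwivediSaxena2022, Claim 3.3 with proof (full version p0027 L724–744); Thm. 3.2 (p0026 L713–715)] -/
theorem ExactTerm.uabp_residue_le_of_formsSat {T : ExactTerm (RatFunc F) n} (hWF : T.WF)
    {N t B s : ℕ} (hcert : T.Cert N t) (hB : T.Bdd B) (hBN : B < N)
    (hreg : T.FormsSat fun a => ∃ (c : RatFunc F) (b : Option (Fin n) → F[X]), c ≠ 0 ∧
      (∀ o, a o = c * algebraMap F[X] (RatFunc F) (b o)) ∧ (b none).coeff 0 ≠ 0)
    (hs : 2 ≤ s) (hn : n + 1 ≤ s) (ht : t ≤ s) (hNs : N ≤ s) (hBs : B ≤ s)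
    {f : FractionRing (MvPolynomial (Fin n) F)} (hT : EpsLim T.val f) :
    ∃ N₀ D₀ : MvPolynomial (Fin n) F, D₀ ≠ 0 ∧
      f * limToFrac F (Fin n) D₀ = limToFrac F (Fin n) N₀ ∧
      UABPComputes (s ^ 10) N₀ ∧ UABPComputes (s ^ 10) D₀ ∧
      N₀.totalDegree ≤ s ^ 10 ∧ D₀.totalDegree ≤ s ^ 10 :=
  ExactTerm.uabp_residue_le hWF hcert hB hBN hreg.1 hreg.2.1 hreg.2.2.1 hreg.2.2.2
    hs hn ht hNs hBs hT

/-- `ExactTerm.uabp_residue_scaled_le` with `T.FormsSat (ε-regular)` — the one-call TOP seam: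
last raw term `T` after the rounds, `λ · T → f_{k−1}`, all sizes `≤ s` ⇒ `f_{k−1} = N₀/D₀` with
programs and degrees within `s ^ 10`.
[cite: DuttaDwivediSaxena2022, Claim 3.3 with proof (full version p0027 L724–744); Thm. 3.2 (p0026 L713–715)] -/
theorem ExactTerm.uabp_residue_scaled_le_of_formsSat {T : ExactTerm (RatFunc F) n} (hWF : T.WF)
    {N t B s : ℕ} (hcert : T.Cert N t) (hB : T.Bdd B) (hBN : B < N)
    (hreg : T.FormsSat fun a => ∃ (c : RatFunc F) (b : Option (Fin n) → F[X]), c ≠ 0 ∧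
      (∀ o, a o = c * algebraMap F[X] (RatFunc F) (b o)) ∧ (b none).coeff 0 ≠ 0)
    (hs : 2 ≤ s) (hn : n + 1 ≤ s) (ht : t ≤ s) (hNs : N ≤ s) (hBs : B ≤ s)
    {c : RatFunc F} (hc : c ≠ 0) {f : FractionRing (MvPolynomial (Fin n) F)}
    (hT : EpsLim (algebraMap (RatFunc F) (FractionRing (MvPolynomial (Fin n) (RatFunc F))) c *
      T.val) f) :
    ∃ N₀ D₀ : MvPolynomial (Fin n) F, D₀ ≠ 0 ∧
      f * limToFrac F (Fin n) D₀ = limToFrac F (Fin n) N₀ ∧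
      UABPComputes (s ^ 10) N₀ ∧ UABPComputes (s ^ 10) D₀ ∧
      N₀.totalDegree ≤ s ^ 10 ∧ D₀.totalDegree ≤ s ^ 10 :=
  ExactTerm.uabp_residue_scaled_le hWF hcert hB hBN hreg.1 hreg.2.1 hreg.2.2.1 hreg.2.2.2
    hs hn ht hNs hBs hc hT

end FormsSatWrappers

end DDS2021

end Literature.Computability.AlgebraicComplexity

end
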